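import Mathlib.Analysis.Calculus.InverseFunctionTheorem.Deriv
import Mathlib.Analysis.Complex.CauchyIntegral
import Mathlib.Analysis.Analytic.IsolatedZeros

/-!
# Values with exactly one simple preimage form an open set

Crux `WitnessCharge` (item stmt-SmoothPoincare4-7824, route route-SmoothPoincare4-SullivanDual),
line `Sketch`, stub `helper_properHolo_goodIsOpen` (degree theory of proper holomorphic maps
between planar open sets, part 3).

Let `Z` be holomorphic on an open set `U ⊆ ℂ` with values in `A`, and assume the fibres
`U ∩ Z ⁻¹' {a}` vary upper semicontinuously in `a ∈ A` (every open set containing the fibre over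
`a₁` contains all fibres over a neighbourhood of `a₁` inside `A`).  Then the set `G` of values
`a ∈ A` with exactly one preimage `ξ₀ ∈ U`, at which moreover `deriv Z ξ₀ ≠ 0`, is open.

Proof: for `a₀ ∈ G` with preimage `ξ₀`, the inverse function theorem
(`HasStrictDerivAt.eventually_left_inverse`, `HasStrictDerivAt.map_nhds_eq`) gives an open
`V ∋ ξ₀`, `V ⊆ U`, on which `Z` is injective with `deriv Z ≠ 0` and such that `Z '' V` is a
neighbourhood of `a₀`.  The fibre over `a₀` is `{ξ₀} ⊆ V`, so upper semicontinuity yields a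
neighbourhood `W ⊆ A` of `a₀` all of whose fibres lie in `V`; then `W ∩ Z '' V ⊆ G`.
-/

noncomputable section

set_option linter.dupNamespace false

open Set Filter Topology Metric

namespace Summit.SmoothPoincare4.SmoothPoincare4.Theorems.WitnessCharge.PencilIncompleteness

/-- **The set of values with exactly one, simple, preimage is open.** Let `Z : ℂ → ℂ` be
holomorphic on the open set `U`, mapping `U` into the open set `A`, and suppose the fibres
`U ∩ Z ⁻¹' {a}` are upper semicontinuous in `a ∈ A`: whenever an open `V` contains the fibre over
`a₁ ∈ A`, it contains the fibres over all `a` in some neighbourhood `W ⊆ A` of `a₁`.  Then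
`{a ∈ A | ∃ ξ₀ ∈ U, Z ξ₀ = a ∧ deriv Z ξ₀ ≠ 0 ∧ ∀ ξ ∈ U, Z ξ = a → ξ = ξ₀}` is open.
Proof: at a preimage `ξ₀` with `deriv Z ξ₀ ≠ 0`, `Z` is analytic (`DifferentiableOn.analyticAt`),
hence strictly differentiable; by the inverse function theorem it is injective with non-vanishing
derivative on an open `V ∋ ξ₀`, `V ⊆ U`, and `Z '' V ∈ 𝓝 (Z ξ₀)` (`HasStrictDerivAt.map_nhds_eq`).
Since the fibre over `Z ξ₀` is `{ξ₀} ⊆ V`, upper semicontinuity gives `W ∈ 𝓝 (Z ξ₀)`, `W ⊆ A`,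
whose fibres all lie in `V`; every `a ∈ W ∩ Z '' V` then has exactly one preimage in `U`, lying
in `V`, where `deriv Z ≠ 0`. -/
theorem helper_properHolo_goodIsOpen :
    ∀ (Z : ℂ → ℂ) (U A : Set ℂ), IsOpen U → IsOpen A → DifferentiableOn ℂ Z U → MapsTo Z U A →
      (∀ a₁ ∈ A, ∀ V : Set ℂ, IsOpen V → U ∩ Z ⁻¹' {a₁} ⊆ V →
        ∃ W ∈ 𝓝 a₁, W ⊆ A ∧ ∀ a ∈ W, U ∩ Z ⁻¹' {a} ⊆ V) →
      IsOpen {a ∈ A | ∃ ξ₀ ∈ U, Z ξ₀ = a ∧ deriv Z ξ₀ ≠ 0 ∧ ∀ ξ ∈ U, Z ξ = a → ξ = ξ₀} := by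
  intro Z U A hU _hA hZ _hZA husc
  rw [isOpen_iff_mem_nhds]
  rintro a₀ ⟨ha₀A, ξ₀, hξ₀U, hZξ₀, hder₀, huniq⟩
  -- `Z` is analytic, hence strictly differentiable, at `ξ₀`
  have han : AnalyticAt ℂ Z ξ₀ := hZ.analyticAt (hU.mem_nhds hξ₀U)
  have hstrict : HasStrictDerivAt Z (deriv Z ξ₀) ξ₀ := han.hasStrictDerivAt
  -- inverse function theorem: a left inverse of `Z` near `ξ₀`
  obtain ⟨g, hg⟩ : ∃ g : ℂ → ℂ, ∀ᶠ z in 𝓝 ξ₀, g (Z z) = z :=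
    ⟨_, hstrict.eventually_left_inverse hder₀⟩
  -- `deriv Z` does not vanish near `ξ₀`
  have hder : ∀ᶠ z in 𝓝 ξ₀, deriv Z z ≠ 0 := han.deriv.continuousAt.eventually_ne hder₀
  -- an open neighbourhood `V ⊆ U` of `ξ₀` on which all of the above hold
  have hall : ∀ᶠ z in 𝓝 ξ₀, z ∈ U ∧ g (Z z) = z ∧ deriv Z z ≠ 0 := by
    filter_upwards [hU.mem_nhds hξ₀U, hg, hder] with z h₁ h₂ h₃
    exact ⟨h₁, h₂, h₃⟩
  obtain ⟨V, hV, hVopen, hξ₀V⟩ := _root_.eventually_nhds_iff.mp hall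
  have hVU : V ⊆ U := fun z hz => (hV z hz).1
  have hinjV : InjOn Z V := by
    intro x hx y hy hxy
    rw [← (hV x hx).2.1, ← (hV y hy).2.1, hxy]
  -- `Z '' V` is a neighbourhood of `a₀ = Z ξ₀`
  have himage : Z '' V ∈ 𝓝 a₀ := by
    have h := image_mem_map (m := Z) (hVopen.mem_nhds hξ₀V)
    rw [hstrict.map_nhds_eq hder₀, hZξ₀] at h
    exact h
  -- the fibre over `a₀` is `{ξ₀} ⊆ V`; apply upper semicontinuity of the fibres
  have hfib : U ∩ Z ⁻¹' {a₀} ⊆ V := by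
    rintro ξ ⟨hξU, hξ⟩
    rw [mem_preimage, mem_singleton_iff] at hξ
    rw [huniq ξ hξU hξ]
    exact hξ₀V
  obtain ⟨W, hW, hWA, hWV⟩ := husc a₀ ha₀A V hVopen hfib
  -- `W ∩ Z '' V` consists of good values
  filter_upwards [hW, himage] with a haW haV
  obtain ⟨ξ, hξV, hξa⟩ := haV
  refine ⟨hWA haW, ξ, hVU hξV, hξa, (hV ξ hξV).2.2, ?_⟩
  intro ξ' hξ'U hξ'a
  have hξ'V : ξ' ∈ V := hWV a haW ⟨hξ'U, by rw [mem_preimage, mem_singleton_iff, hξ'a]⟩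
  exact hinjV hξ'V hξV (hξ'a.trans hξa.symm)

end Summit.SmoothPoincare4.SmoothPoincare4.Theorems.WitnessCharge.PencilIncompleteness
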